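import Mathlib
import HarnessLib
import Summits.AtomisticToContinuum.Crystallization.Theses.EnergyDerivativeOrder
import Summits.AtomisticToContinuum.Crystallization.Theorems.EnergyDerivativeOrderLimitTransferHcpShells

/-!
# Route EnergyDerivativeOrder · crux C2 `SpectralRigidityHcp` (stmt-AtomisticToContinuum-12278) —
# typed decomposition and its assembly

Crux-strategist split (seat `planner-cstrat-stmt-AtomisticToContinuum-12278-r1-0`, 2026-08-17) of
the distance-spectrum rigidity crux

  `SpectralRigidityHcp`: for `0 < a`, `|h/a − √(2/3)| ≤ 1/400`, every nonempty `Y ⊆ ℝ³` whose pair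
  distances are distances of `hcpStacking a h` and in which every point has exactly twelve other
  points of `Y` within `6a/5` is `g '' hcpStacking a h` for an isometry `g`,

into three pieces of different mathematical kind (the classical architecture of Hales's
"kissing-twelve ⇒ hexagonal layers" argument, *Dense Sphere Packings* §1.3, transplanted from
contact data to distance-spectrum data and relaxed to the two-parameter family `hcp(a,h)`):

* **P1 `TwoRadiusShellPatterns`** (LOCAL, a finite classification): a twelve-point set `T` with
  radii in `{a, a'}`, `a' = √(a²/3 + h²)`, and all mutual distances in the hcp spectrum is a
  rotated copy of the first shell of `0` in `hcpStacking a h` (anticuboctahedral pattern) or in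
  `fccStacking a h` (cuboctahedral pattern; realisable only at the ideal ratio).
* **P2 `ShellsPropagateToBarlow`** (LOCAL-TO-GLOBAL): a nonempty set all of whose punctured
  `6a/5`-neighbourhoods are such rotated hcp/fcc shells is an isometric image of a Barlow stacking
  `barlowStacking a h s` of some Hägg sequence `s` (Hales DSP §1.3 = the tree's
  `HalesDSP_layerPackings_holds` at the ideal ratio; the relaxed ratio is new).
* **P3 `SpectrumSelectsHcp`** (ARITHMETIC of Hägg sequences): a Barlow stacking all of whose pair
  distances lie in the hcp spectrum is an isometric image of `hcpStacking a h` (a cubic-type layer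
  triple `s (k−1) = s k` produces the squared distance `a²/3 + 4h²`, not in the spectrum unless
  `h² = ⅔a²`, and then `16a²/3 + 4h² = 8a²`, and `8` is not in the ideal squared spectrum).

`energyDerivativeOrder_spectralRigidityHcp_of_subs : P1 → P2 → P3 → SpectralRigidityHcp` is the
assembly, PROVED here (shape `C₁ → C₂ → C₃ → C` for
`ledger route edit --split SpectralRigidityHcp --glue-by`). It is not a seam of logic: it computes
the bottom of the relaxed hcp spectrum in the window (`hcp_dist_eq_of_le_window`: two distinct hcp
sites within `6a/5` are at distance `a` or `a'`, from `dist_sq_cases_of_mem` of the LimitTransfer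
helper file and the window numerics `window_second_shell_bounds`), recentres every punctured
neighbourhood to a twelve-point two-radius spectral set (cardinality under translation, radii via
the spectral bottom, mutual distances by translation invariance), feeds P1 then P2, transports the
spectral hypothesis through the isometry delivered by P2, applies P3 and composes the isometries.
The three piece statements are spelled out verbatim in the theorem's binders (they become the
route decls `TwoRadiusShellPatterns`, `ShellsPropagateToBarlow`, `SpectrumSelectsHcp` on the split).

No `def`s; unconditional; standard axioms; no named facts.  WORKFILE namespace
`…Cruxes.SpectralRigidityHcp.Split`; a prover landing it under `Theorems/` (prover-only, D-0016)
renames the namespace to `Summit.AtomisticToContinuum.Crystallization.Theorems` and closes the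
glue item `TwoRadiusShellPatterns → ShellsPropagateToBarlow → SpectrumSelectsHcp → SpectralRigidityHcp`.
-/

noncomputable section

namespace Summit.AtomisticToContinuum.Crystallization.Cruxes.SpectralRigidityHcp.Split

open Literature.MathematicalPhysics.StatisticalMechanics
open Summit.AtomisticToContinuum.Crystallization.Theses.EnergyDerivativeOrder
open Summit.AtomisticToContinuum.Crystallization.Theorems.EnergyDerivativeOrderLimitTransfer
open Set Metric

/-- **Window numerics.** In the window `|h/a − √(2/3)| ≤ 1/400` (`a > 0`): `h > 0`, and the
radius `6a/5` is below the three second-shell bounds `3a²`, `4a²/3 + h²`, `4h²` of a relaxed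
Barlow stacking (`√(2/3) > 0.8164`, so `h ≥ 0.8139 a`). [folklore] -/
theorem window_second_shell_bounds {a h : ℝ} (ha : 0 < a)
    (hwin : |h / a - Real.sqrt (2 / 3)| ≤ 1 / 400) :
    0 < h ∧ (6 / 5 * a) ^ 2 < 3 * a ^ 2 ∧ (6 / 5 * a) ^ 2 < 4 * a ^ 2 / 3 + h ^ 2 ∧
      (6 / 5 * a) ^ 2 < 4 * h ^ 2 := by
  have hs1 : (8164 / 10000 : ℝ) < Real.sqrt (2 / 3) := by
    rw [Real.lt_sqrt (by norm_num)]; norm_num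
  have hlow : (8139 / 10000 : ℝ) ≤ h / a := by
    have := (abs_le.1 hwin).1
    linarith
  have hha : (8139 / 10000 : ℝ) * a ≤ h := by
    rwa [le_div_iff₀ ha] at hlow
  have hh : 0 < h := lt_of_lt_of_le (by positivity) hha
  refine ⟨hh, by nlinarith, by nlinarith, by nlinarith⟩

/-- **Bottom of the relaxed hcp spectrum.** In the window, two distinct sites of
`hcpStacking a h` at distance `≤ 6a/5` are first-shell neighbours: their distance is `a` or
`a' = √(a²/3 + h²)` (`dist_sq_cases_of_mem`: `a²`, `a²/3 + h²`, or beyond a second-shell bound).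
[folklore] -/
theorem hcp_dist_eq_of_le_window {a h : ℝ} (ha : 0 < a)
    (hwin : |h / a - Real.sqrt (2 / 3)| ≤ 1 / 400) {p q : EuclideanSpace ℝ (Fin 3)}
    (hp : p ∈ hcpStacking a h) (hq : q ∈ hcpStacking a h) (hpq : p ≠ q)
    (hle : dist p q ≤ 6 / 5 * a) :
    dist p q = a ∨ dist p q = Real.sqrt (a ^ 2 / 3 + h ^ 2) := by
  obtain ⟨-, h1, h2, h3⟩ := window_second_shell_bounds ha hwin
  have hd2 : dist p q ^ 2 ≤ (6 / 5 * a) ^ 2 := pow_le_pow_left₀ dist_nonneg hle 2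
  rcases dist_sq_cases_of_mem (a := a) (h := h) isHaggSeq_alternating hp hq hpq with hd | hd | hbig
  · left
    rw [← Real.sqrt_sq (dist_nonneg (x := p) (y := q)), hd, Real.sqrt_sq ha.le]
  · right
    rw [← Real.sqrt_sq (dist_nonneg (x := p) (y := q)), hd]
  · exfalso
    rcases hbig with hb | hb | hb <;> linarith

/-- **Assembly of the typed decomposition of the crux `SpectralRigidityHcp` (C2 of route
EnergyDerivativeOrder, stmt-AtomisticToContinuum-12278):**
`TwoRadiusShellPatterns → ShellsPropagateToBarlow → SpectrumSelectsHcp → SpectralRigidityHcp`,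
the three hypotheses being the piece statements P1 (two-radius shell patterns), P2 (shells
propagate to a Barlow stacking), P3 (the spectrum selects hcp among Barlow stackings) verbatim.
Proof: bottom of the spectrum (`hcp_dist_eq_of_le_window`) ⇒ every punctured `6a/5`-neighbourhood,
recentred, is a twelve-point two-radius set with spectral mutual distances ⇒ (P1) a rotated hcp/fcc
first shell ⇒ (P2) `Y = g '' barlowStacking a h s` ⇒ the spectral hypothesis pulls back through
`g` ⇒ (P3) `barlowStacking a h s = g' '' hcpStacking a h` ⇒ `Y = (g' ≫ g) '' hcpStacking a h`.
[cite: HalesDSP2012, §1.3] -/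
theorem energyDerivativeOrder_spectralRigidityHcp_of_subs
    (h1 : ∀ a h : ℝ, 0 < a → |h / a - Real.sqrt (2 / 3)| ≤ 1 / 400 → ∀ T : Set (EuclideanSpace ℝ (Fin 3)), T.ncard = 12 → (∀ t ∈ T, dist 0 t = a ∨ dist 0 t = Real.sqrt (a ^ 2 / 3 + h ^ 2)) → (∀ t ∈ T, ∀ t' ∈ T, t ≠ t' → ∃ p ∈ hcpStacking a h, ∃ q ∈ hcpStacking a h, dist t t' = dist p q) → ∃ A : EuclideanSpace ℝ (Fin 3) →ₗᵢ[ℝ] EuclideanSpace ℝ (Fin 3), T = A '' {p ∈ hcpStacking a h | p ≠ 0 ∧ dist 0 p ≤ 6 / 5 * a} ∨ T = A '' {p ∈ fccStacking a h | p ≠ 0 ∧ dist 0 p ≤ 6 / 5 * a})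
    (h2 : ∀ a h : ℝ, 0 < a → |h / a - Real.sqrt (2 / 3)| ≤ 1 / 400 → ∀ Y : Set (EuclideanSpace ℝ (Fin 3)), Y.Nonempty → (∀ y ∈ Y, ∃ A : EuclideanSpace ℝ (Fin 3) →ₗᵢ[ℝ] EuclideanSpace ℝ (Fin 3), {y' ∈ Y | y' ≠ y ∧ dist y y' ≤ 6 / 5 * a} = (fun p => y + A p) '' {p ∈ hcpStacking a h | p ≠ 0 ∧ dist 0 p ≤ 6 / 5 * a} ∨ {y' ∈ Y | y' ≠ y ∧ dist y y' ≤ 6 / 5 * a} = (fun p => y + A p) '' {p ∈ fccStacking a h | p ≠ 0 ∧ dist 0 p ≤ 6 / 5 * a}) → ∃ s : ℤ → ℤ, IsHaggSeq s ∧ ∃ g : EuclideanSpace ℝ (Fin 3) ≃ᵢ EuclideanSpace ℝ (Fin 3), Y = g '' barlowStacking a h s)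
    (h3 : ∀ a h : ℝ, 0 < a → |h / a - Real.sqrt (2 / 3)| ≤ 1 / 400 → ∀ s : ℤ → ℤ, IsHaggSeq s → (∀ p ∈ barlowStacking a h s, ∀ q ∈ barlowStacking a h s, p ≠ q → ∃ p' ∈ hcpStacking a h, ∃ q' ∈ hcpStacking a h, dist p q = dist p' q') → ∃ g : EuclideanSpace ℝ (Fin 3) ≃ᵢ EuclideanSpace ℝ (Fin 3), barlowStacking a h s = g '' hcpStacking a h) :
    SpectralRigidityHcp := by
  intro a h ha hwin Y hY hD hN
  -- Step 1 (local data, recentred): every punctured `6a/5`-neighbourhood, translated to the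
  -- origin, is a twelve-point two-radius set with mutual distances in the hcp spectrum, hence
  -- (P1) a rotated copy of the hcp or of the fcc first shell.
  have hshell : ∀ y ∈ Y, ∃ A : EuclideanSpace ℝ (Fin 3) →ₗᵢ[ℝ] EuclideanSpace ℝ (Fin 3),
      {y' ∈ Y | y' ≠ y ∧ dist y y' ≤ 6 / 5 * a} =
          (fun p => y + A p) '' {p ∈ hcpStacking a h | p ≠ 0 ∧ dist 0 p ≤ 6 / 5 * a} ∨
        {y' ∈ Y | y' ≠ y ∧ dist y y' ≤ 6 / 5 * a} =
          (fun p => y + A p) '' {p ∈ fccStacking a h | p ≠ 0 ∧ dist 0 p ≤ 6 / 5 * a} := by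
    intro y hy
    set N : Set (EuclideanSpace ℝ (Fin 3)) := {y' ∈ Y | y' ≠ y ∧ dist y y' ≤ 6 / 5 * a}
      with hNdef
    set T : Set (EuclideanSpace ℝ (Fin 3)) := (fun y' => y' - y) '' N with hTdef
    -- twelve points (translation is injective)
    have hTcard : T.ncard = 12 := by
      rw [hTdef, Set.ncard_image_of_injective _ sub_left_injective]
      exact hN y hy
    -- radii `a` or `a'`: the distance to the centre is a realised hcp distance `≤ 6a/5`
    have hTrad : ∀ t ∈ T, dist 0 t = a ∨ dist 0 t = Real.sqrt (a ^ 2 / 3 + h ^ 2) := by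
      rintro _ ⟨y', ⟨hy'Y, hne, hle⟩, rfl⟩
      have hd : dist (0 : EuclideanSpace ℝ (Fin 3)) (y' - y) = dist y y' := by
        rw [dist_comm, dist_zero_right, ← dist_eq_norm, dist_comm]
      obtain ⟨p, hp, q, hq, hpq⟩ := hD y hy y' hy'Y (Ne.symm hne)
      have hpq' : p ≠ q := by
        rintro rfl
        rw [dist_self, dist_eq_zero] at hpq
        exact hne hpq.symm
      rw [hd, hpq]
      exact hcp_dist_eq_of_le_window ha hwin hp hq hpq' (hpq ▸ hle)
    -- mutual distances are realised hcp distances (translation invariance)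
    have hTdist : ∀ t ∈ T, ∀ t' ∈ T, t ≠ t' →
        ∃ p ∈ hcpStacking a h, ∃ q ∈ hcpStacking a h, dist t t' = dist p q := by
      rintro _ ⟨y₁, ⟨h₁Y, -, -⟩, rfl⟩ _ ⟨y₂, ⟨h₂Y, -, -⟩, rfl⟩ hne
      have h12 : y₁ ≠ y₂ := fun h0 => hne (by rw [h0])
      obtain ⟨p, hp, q, hq, hpq⟩ := hD y₁ h₁Y y₂ h₂Y h12
      refine ⟨p, hp, q, hq, ?_⟩
      rw [← hpq, dist_eq_norm, dist_eq_norm, sub_sub_sub_cancel_right]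
    -- P1, then translate back
    obtain ⟨A, hA⟩ := h1 a h ha hwin T hTcard hTrad hTdist
    have hNT : (fun t => y + t) '' T = N := by
      rw [hTdef, Set.image_image]
      simp
    refine ⟨A, ?_⟩
    rcases hA with hA | hA
    · left
      rw [← hNT, hA, Set.image_image]
    · right
      rw [← hNT, hA, Set.image_image]
  -- Step 2 (local-to-global, P2): `Y` is an isometric image of a Barlow stacking.
  obtain ⟨s, hs, g, hYg⟩ := h2 a h ha hwin Y hY hshell
  -- Step 3: the spectral hypothesis pulls back through the isometry `g` …
  have hdistS : ∀ p ∈ barlowStacking a h s, ∀ q ∈ barlowStacking a h s, p ≠ q →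
      ∃ p' ∈ hcpStacking a h, ∃ q' ∈ hcpStacking a h, dist p q = dist p' q' := by
    intro p hp q hq hpq
    have hgp : g p ∈ Y := by rw [hYg]; exact Set.mem_image_of_mem g hp
    have hgq : g q ∈ Y := by rw [hYg]; exact Set.mem_image_of_mem g hq
    have hne : g p ≠ g q := fun h0 => hpq (g.injective h0)
    obtain ⟨p', hp', q', hq', hd⟩ := hD (g p) hgp (g q) hgq hne
    exact ⟨p', hp', q', hq', by rw [← hd, g.dist_eq]⟩
  -- … and P3 selects hcp; compose the two isometries.
  obtain ⟨g', hg'⟩ := h3 a h ha hwin s hs hdistS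
  refine ⟨g'.trans g, ?_⟩
  rw [hYg, hg', Set.image_image]
  rfl

end Summit.AtomisticToContinuum.Crystallization.Cruxes.SpectralRigidityHcp.Split

end
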